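import Literature.NumberTheory.GaloisRepresentations.ContinuousH1TorsionOfRegularScalar
import Literature.NumberTheory.GaloisRepresentations.ContinuousCohomologyConnecting
import HarnessLib

/-!
# `e`-torsion classes of `H¹_cont(G, X)` for an INJECTIVE equivariant endomorphism `e : X ⟶ X`
# (Greenberg 2010 §2, (7)/(8) in the `ℤ`-linear currency: `θ ∈ Λ` acting through `H¹(θ̂)`)

Topic `NumberTheory/GaloisRepresentations`; namespace `Literature.NumberTheory.GaloisRepresentations`.
THEOREMS ONLY (no definition, no named fact, no `sorry`). Companion of
`ContinuousH1TorsionOfRegularScalar.lean` (same seat, brick C3 of the road memo «SUR-Λ», cell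
`bsd-eis`, crux 2 `GoodLatticeBDPValue` = stmt-BirchSwinnertonDyer-19032): there the scalar `θ : R`
acts on `X : TopRep R G` and on `H¹`; HERE the coefficient action is through a morphism `e : X ⟶ X` of
topological representations (equivariant, continuous, `k`-linear) and `Hⁿ(e) = cohomologyMap e n`
(`ContinuousCohomologyConnecting.lean`). This is the form needed when the compact `Λ`-adic dual
`T* = lim_k (D[𝔪ᵏ])^D` is built as a `ℤ`-linear inverse limit (`DiscreteModuleInverseLimit.lean`,
`DiscreteInvSystem.limitRep : TopRep ℤ Γ`) on which `θ ∈ Λ` acts by the equivariant endomorphism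
`θ̂`, so that "`θ • y = 0`" reads `cohomologyMap θ̂ 1 y = 0`.

PRINT. R. Greenberg, *Surjectivity of the global-to-local map defining a Selmer group*, Kyoto J.
Math. 50 (2010), §2.1 pp. 7–8: "(7) `H⁰(K, T*) → H⁰(K, T*/θT*) → H¹(K_Σ/K, T*)[θ] → 0` … the map
(8) `H¹(K, T*)_{Λ-tors} → H¹(K_η, T*)_{Λ-tors}` is injective" (given `H⁰(K_η, T*) = 0`); §2.3 p. 13
(proof of Prop. 2.3.2): "assumption (i) implies that the first map is injective. It is the map (8)".

* `exists_hom_apply_eq_sub_of_cohomologyMap_oneCocycleClass_eq_zero` — (7) backwards: `H¹(e)[φ] = 0`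
  gives `t` with `e(φ g) = g • t − t`; converse `cohomologyMap_oneCocycleClass_eq_zero_of_exists`.
* `oneCocycleClass_eq_zero_of_hom_apply_eq_sub_hom` — if that `t` is `e u`, the class dies (`e` injective).
* `eq_zero_of_cohomologyMap_eq_zero_of_forall_invariant_mod` — Prop. 2.2.1's form
  ("`H⁰(G, X/eX) = 0 ⇒ H¹(G, X)[e] = 0`").
* `eq_zero_of_cohomologyMap_eq_zero_of_map_eq_zero` — **(8)**: `H¹(e) y = 0`, the restriction of `y`
  along `ι : H →ₜ* G` vanishes, `X^{ι(H)} = 0`, `e` injective ⇒ `y = 0`.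

HONEST FRAMING: generic cocycle algebra toward the kernel discharge of `Greenberg2016.prop263_sur_of_crk`
(not proved here); nothing summit-side; no case of BSD. AI-typed, kernel-checked.

## References
* [Greenberg2010] R. Greenberg, Kyoto J. Math. 50 (2010), doi:10.1215/0023608x-2010-016 — §2.1
  pp. 7–8 ((7), (8)), §2.2 p. 9 (proof of Prop. 2.2.1), §2.3 p. 13 (proof of Prop. 2.3.2).
-/

noncomputable section

open CategoryTheory

universe u v

namespace Literature.NumberTheory.GaloisRepresentations

open TopRep ContinuousCohomology

variable {k : Type u} [CommRing k] [TopologicalSpace k]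
variable {G : Type v} [Group G] [TopologicalSpace G] [IsTopologicalGroup G]
variable (X : TopRep.{v} k G)

/-! ### §1. (7) for an endomorphism -/

/-- **(7), backwards, endomorphism form**: if `H¹(e)[φ] = 0` then `e(φ g) = g • t − t` for one
`t ∈ X`. [cite: Greenberg2010, §2.1 pp. 7–8, (7)] -/
theorem exists_hom_apply_eq_sub_of_cohomologyMap_oneCocycleClass_eq_zero (e : X ⟶ X)
    (φ : contOneCocycles X) (h : cohomologyMap e 1 (oneCocycleClass X φ) = 0) :
    ∃ t : X, ∀ g : G, e.hom (φ.1 g) = X.ρ g t - t := by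
  rw [cohomologyMap_oneCocycleClass, oneCocycleClass_eq_zero_iff] at h
  obtain ⟨t, ht⟩ := h
  exact ⟨t, fun g => by rw [← pullback_id_resIdHom_apply e φ g, ht g]⟩

/-- Converse: `e(φ g) = g • t − t` for all `g` gives `H¹(e)[φ] = 0`. [cite: Greenberg2010, §2.1 pp. 7–8, (7)] -/
theorem cohomologyMap_oneCocycleClass_eq_zero_of_exists (e : X ⟶ X) (φ : contOneCocycles X)
    {t : X} (ht : ∀ g : G, e.hom (φ.1 g) = X.ρ g t - t) :
    cohomologyMap e 1 (oneCocycleClass X φ) = 0 := by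
  rw [cohomologyMap_oneCocycleClass, oneCocycleClass_eq_zero_iff]
  exact ⟨t, fun g => by rw [pullback_id_resIdHom_apply, ht g]⟩

/-- **(7), exactness, endomorphism form**: if `e(φ g) = g • e(u) − e(u)` with `e` injective, then
`[φ] = 0` (`φ g = g • u − u`, `e` being equivariant). [cite: Greenberg2010, §2.1 pp. 7–8, (7)] -/
theorem oneCocycleClass_eq_zero_of_hom_apply_eq_sub_hom (e : X ⟶ X)
    (he : Function.Injective e.hom) (φ : contOneCocycles X) (u : X)
    (hφ : ∀ g : G, e.hom (φ.1 g) = X.ρ g (e.hom u) - e.hom u) : oneCocycleClass X φ = 0 := by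
  rw [oneCocycleClass_eq_zero_iff]
  refine ⟨u, fun g => he ?_⟩
  rw [hφ g, map_sub, TopRep.hom_comm_apply e g u]

/-- **Prop. 2.2.1's use of (7), endomorphism form**: if every `t ∈ X` with `g • t − t ∈ e(X)` for all
`g` lies in `e(X)` ("`H⁰(G, X/eX) = 0`"), then `H¹(e) y = 0 ⇒ y = 0` (`e` injective).
[cite: Greenberg2010, §2.2 p. 9 L40–41 (proof of Prop. 2.2.1) with §2.1 (7)] -/
theorem eq_zero_of_cohomologyMap_eq_zero_of_forall_invariant_mod (e : X ⟶ X)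
    (he : Function.Injective e.hom)
    (hH0 : ∀ t : X, (∀ g : G, ∃ x : X, X.ρ g t - t = e.hom x) → ∃ u : X, t = e.hom u)
    (y : continuousCohomology 1 X) (hy : cohomologyMap e 1 y = 0) : y = 0 := by
  obtain ⟨φ, rfl⟩ := oneCocycleClass_surjective X y
  obtain ⟨t, ht⟩ := exists_hom_apply_eq_sub_of_cohomologyMap_oneCocycleClass_eq_zero X e φ hy
  obtain ⟨u, rfl⟩ := hH0 t fun g => ⟨φ.1 g, (ht g).symm⟩
  exact oneCocycleClass_eq_zero_of_hom_apply_eq_sub_hom X e he φ u ht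

/-! ### §2. (8) for an endomorphism -/

variable {H : Type v} [Group H] [TopologicalSpace H] [IsTopologicalGroup H]

omit [IsTopologicalGroup H] in
/-- **(8), cocycle + endomorphism form**: `ι : H →ₜ* G`, `X^{ι(H)} = 0`, `e` injective equivariant;
if `e(φ g) = g • t − t` and `φ ∘ ι` is principal then `[φ] = 0`.
[cite: Greenberg2010, §2.1 p. 8 L1–10, (8); §2.3 p. 13 L32–34] -/
theorem oneCocycleClass_eq_zero_of_cohomologyMap_eq_zero_of_restrict (ι : H →ₜ* G) (e : X ⟶ X)
    (he : Function.Injective e.hom)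
    (hH0 : ∀ x : X, (∀ h : H, X.ρ (ι h) x = x) → x = 0)
    (φ : contOneCocycles X) {t : X} (ht : ∀ g : G, e.hom (φ.1 g) = X.ρ g t - t)
    {u : X} (hu : ∀ h : H, φ.1 (ι h) = X.ρ (ι h) u - u) : oneCocycleClass X φ = 0 := by
  have hinv : ∀ h : H, X.ρ (ι h) (t - e.hom u) = t - e.hom u := fun h => by
    have h1 := ht (ι h)
    rw [hu h, map_sub, TopRep.hom_comm_apply e (ι h) u] at h1
    rw [map_sub]
    exact sub_eq_sub_iff_sub_eq_sub.mp h1.symm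
  have ht0 : t = e.hom u := sub_eq_zero.1 (hH0 _ hinv)
  refine oneCocycleClass_eq_zero_of_hom_apply_eq_sub_hom X e he φ u fun g => ?_
  rw [ht g, ht0]

/-- **(8) on classes, endomorphism form**: `H¹(e) y = 0`, the restriction of `y` along `ι` vanishes,
`X^{ι(H)} = 0`, `e` injective ⇒ `y = 0`. [cite: Greenberg2010, §2.1 p. 8 L8–10, (8); §2.3 p. 13 L32–34] -/
theorem eq_zero_of_cohomologyMap_eq_zero_of_map_eq_zero (ι : H →ₜ* G) (e : X ⟶ X)
    (he : Function.Injective e.hom)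
    (hH0 : ∀ x : X, (∀ h : H, X.ρ (ι h) x = x) → x = 0)
    (y : continuousCohomology 1 X) (hy : cohomologyMap e 1 y = 0)
    (hres : ContinuousCohomology.map ι (𝟙 (res (ι : H →* G) X)) 1 y = 0) : y = 0 := by
  obtain ⟨φ, rfl⟩ := oneCocycleClass_surjective X y
  obtain ⟨t, ht⟩ := exists_hom_apply_eq_sub_of_cohomologyMap_oneCocycleClass_eq_zero X e φ hy
  rw [map_oneCocycleClass, oneCocycleClass_eq_zero_iff] at hres
  obtain ⟨u, hu⟩ := hres
  refine oneCocycleClass_eq_zero_of_cohomologyMap_eq_zero_of_restrict X ι e he hH0 φ ht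
    (u := u) fun h => ?_
  have h1 := hu h
  rw [contOneCocycles.pullback_apply] at h1
  change φ.1 (ι h) = X.ρ (ι h) u - u at h1
  exact h1

/-- **(8) for a commuting family of injective endomorphisms** ("`Λ`-torsion": `y` killed by SOME
injective `e` of the family): restriction is injective on such classes when `X^{ι(H)} = 0`.
[cite: Greenberg2010, §2.1 p. 8 L8–10, (8)] -/
theorem eq_zero_of_exists_cohomologyMap_eq_zero_of_map_eq_zero (ι : H →ₜ* G) {E : Type*}
    (e : E → (X ⟶ X)) (he : ∀ a, Function.Injective (e a).hom)
    (hH0 : ∀ x : X, (∀ h : H, X.ρ (ι h) x = x) → x = 0)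
    (y : continuousCohomology 1 X) (hy : ∃ a : E, cohomologyMap (e a) 1 y = 0)
    (hres : ContinuousCohomology.map ι (𝟙 (res (ι : H →* G) X)) 1 y = 0) : y = 0 := by
  obtain ⟨a, ha⟩ := hy
  exact eq_zero_of_cohomologyMap_eq_zero_of_map_eq_zero X ι (e a) (he a) hH0 y ha hres

end Literature.NumberTheory.GaloisRepresentations

end
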